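import Mathlib
import HarnessLib
import HarnessLib.Audit
import Summits.NavierStokesRegularity.Statement
import Literature.Analysis.FluidPDE.ClassicalSolution
import Literature.Analysis.FluidPDE.LerayHopf
import Literature.Analysis.FluidPDE.NSWave0
import Literature.Analysis.FluidPDE.LoopCirculation
import Summits.NavierStokesRegularity.NavierStokesRegularity.Theorems.TypeICertificateLadderNoBlowupToClay
import HarnessLib.Audit.Status.Attr

/-!
Route: TautLoopKelvin

# Route TautLoopKelvin — Kelvin at taut loops — a pressure-free one-sided law for the
circulation–length spectrum; quantum circles cannot collapse

X = QuantumCircleNonCollapse ("it suffices to show"): for every ν > 0 and every classical solution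
of unforced NS on ℝ³×[0,T) that is
Leray–Hopf from a rapidly decaying datum, and every level g > 0, there is r₀ > 0 such that NO planar
circle of radius r < r₀, at any time
t < T, carries circulation |∮u(t)·dl| ≥ g ("quantum circles cannot collapse before T"). With the
in-tree entry ticket CirculationFloor
(stmt-NavierStokesRegularity-1538: blow-up at T ⇒ circles of radius → 0 carrying |∮u·dl| ≥ c₀ν, the
loop form of Cheskidov–Shvydkoy
arXiv:0708.3067 Lemma 3.2) X is EQUIVALENT to no blow-up; the route's content is the decomposition X
⇐ TautLoopLaw ∧ TautCompressionIntegrable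
through a NEW OBJECT, the circulation–length spectrum ℓ(g,t) := inf{length(C) : C a C¹ loop, |∮_C
u(t)·dl| ≥ g} (valued in [0,∞], inf ∅ = ∞) and its
minimisers, the TAUT LOOPS (flux-constrained length minimisers = closed magnetic geodesics of ω with
potential u). Deciding theorem (rev 1,
CRUX-ONLY): closes (hK1 : TautCompressionIntegrable) (hLaw : TautLoopLaw) (hFloor :
CirculationFloor) : NavierStokesRegularity, with the circle
reduction proved inline and the proved frame stmt-0055 invoked as the tree theorem
typeICertificateLadder_noBlowupToClay_proof. Realises card taut-loop-kelvin-law (spine, sole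
card; graded new-mechanism by the mechanism critic 2026-08-16).
Lean: `∀ (ν T : ℝ), 0 < ν → 0 < T → ∀ (u : ℝ → EuclideanSpace ℝ (Fin 3) → EuclideanSpace ℝ (Fin 3))
(p : ℝ → EuclideanSpace ℝ (Fin 3) → ℝ), Literature.Analysis.FluidPDE.IsClassicalNSSolutionOn
(Set.Ico 0 T) ν 0 u p → Literature.Analysis.FluidPDE.IsLerayHopfOn T ν 0 (u 0) u →
Literature.Analysis.FluidPDE.HasRapidSpatialDecay (u 0) → ∀ g : ℝ, 0 < g → ∃ r₀ : ℝ, 0 < r₀ ∧ ∀ t ∈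
Set.Ico 0 T, ∀ (c e₁ e₂ : EuclideanSpace ℝ (Fin 3)) (r : ℝ), 0 < r → ‖e₁‖ = 1 → ‖e₂‖ = 1 → inner ℝ
e₁ e₂ = 0 → g ≤ |∫ θ in (0 : ℝ)..(2 * Real.pi), inner ℝ (u t (c + (r * Real.cos θ) • e₁ + (r *
Real.sin θ) • e₂)) ((-(r * Real.sin θ)) • e₁ + (r * Real.cos θ) • e₂)| → r₀ ≤ r`

## Assembly
Crux-only deciding theorem, sorry-free in Sketch2.lean / glue2.lean (≈90 lines): refine the PROVED
frame
typeICertificateLadder_noBlowupToClay_proof (stmt-0055); given ν, T, u, p with the three hypotheses,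
suppose no smooth extension past T;
rapid decay (n = K = 0) bounds |u₀| ≤ C := max C₀ 1; TautCompressionIntegrable at g = c₀ν gives (Φ,
M); put ρ := (g/C)e^(−M) > 0;
CirculationFloor with δ := ρ/(8π) gives a circle of radius r ≤ δ at some t < T with |∮u(t)·dl| ≥ g;
the circle is a C¹ loop
(isC1Loop_circleLoop) whose circulation is the Floor's angle integral (circulation_circleLoop), so
ℓ(g,t) ≤ length ≤ 4πr (deriv_circleLoop);
TautLoopLaw from 0 to t gives ℓ(g,t) ≥ ℓ(g,0)e^(−M) and every admissible loop at time 0 has length ≥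
g/C (|∮u₀·dl| ≤ C·length), so
ρ ≤ 4πr ≤ ρ/2 — contradiction (linarith). The informal Assembly item records the composition.

Rationale: WHY THIS LINE. Kelvin's theorem d/dt ∮_{X_t C} u·dl = ν ∮_{X_t C} Δu·dl is the one exact Lagrangian
law of NS in which the pressure (and ∇|u|²/2) is absent,
but it is unusable for regularity because material loops deform without control; asking "which
loop?" and answering "the SHORTEST loop
carrying circulation g" turns it into a maximum principle in loop space: at a taut loop the map a ↦
∮_{C*+a}u·dl is maximal at a = 0 (else
translate and shrink), so Σ∂²_a = ∮_{C*}Δu·dl ≤ 0 — viscosity can only DRAIN circulation from taut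
loops (support TautLoopStatic) — and
pulling the taut loops of time t+h back along the flow gives the one-sided TAUT-LOOP LAW D₊ log
ℓ(g,·) ≥ −Λ_g, Λ_g = mean tangential
compression −⨍⟨τ,(∇u)τ⟩ over (near-)taut loops (crux TautLoopLaw; Lamb–Oseen = equality, Burgers
vortex = stationarity, Lundgren's
collapsing strained tube = saturation). Hence T is a blow-up time iff ∫^T Λ_{c₀ν} = +∞ (crux
TautCompressionIntegrable is its negation):
a REFINED BKM that is length-valued, localised on one variationally selected family of curves, blind
to benign sheet thinning (a sheet of
jump Δu carries its quantum on loops of length ≈ 2c₀ν/Δu whatever its thickness, and in-plane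
stretching LENGTHENS them) and sensitive
only to circulation concentration. Imported: second variation at an extremal geometric object
(Hamilton's isoperimetric estimate for Ricci
flow, Huisken's distance comparison for curve shortening; closed magnetic geodesics,
arXiv:0912.5226, arXiv:1305.1871) married to Kelvin
(Majda–Bertozzi §1.6; stochastic form doi:10.1002/cpa.20192). No listed route has a loop-space or
length-valued law: circulation enters
CoreLogGas/CirculationRelay as bookkeeping and ThreadingFlux as a static unsigned flux; the nearest
a-priori statement in print,
Córdoba–Fefferman doi:10.1007/s002200100502 + Tao arXiv:1108.1165 Prop. 52 (∫‖u‖_∞dt < ∞), forbids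
only the collapse of MATERIAL tubes,
whereas taut loops are re-selected at every instant. The negatives index (3 items: AdiabaticEddy
corrector, SymmetryModuliCount moduli,
Blowup X5b double negation) is untouched.

RANKED CRUXES. #0 QuantumCircleNonCollapse (target) — X as in § Thesis: for every classical
Leray–Hopf solution from a rapidly decaying datum on [0,T) and every g > 0 there is r₀ > 0 such that
every planar circle (orthonormal frame, radius r > 0) with |circulation| ≥ g at some t ∈ [0,T) has r
≥ r₀. (why it might fail: with CirculationFloor it is equivalent to no blow-up: it fails exactly on
a finite-time singularity (circulation c₀ν on circles of radius → 0), e.g. Hou's interior scenario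
arXiv:2107.06509 if real.) [arXiv:0708.3067, BealeKatoMajda1984, arXiv:2107.06509]
#2 TautCompressionIntegrable (crux) — card K1 in leakage-free sufficient form — for every classical
Leray–Hopf solution from a rapidly decaying datum on [0,T) and every level g > 0, the near-taut
compression rate Λ_g(s) := inf_{ε>0} sup{ −⨍_C⟨τ,(∇u(s))τ⟩ : C a C¹ loop, |∮_C u(s)·dl| ≥ g,
length(C) ≤ ℓ(g,s)+ε } has a measurable majorant Φ on (0,T) with ∫₀ᵀ Φ⁺ ≤ M < ∞ (tangential
compression of the taut quantum loops is time-integrable up to T). [difficulty: open-problem] (why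
it might fail: Λ_g ≤ ‖∇u‖_∞ so it holds up to any regular time, but the law is SATURATED (not
violated) by Lundgren's self-similarly collapsing strained core: K1 fails iff a super-Burgers strain
on a quantum tube is self-fed until T — the tube scenario itself, carrying the supercritical gap.)
[Lundgren1982, BealeKatoMajda1984, MoffattKidaOhkitani1994, arXiv:1108.1165]
#3 TautLoopLaw (crux) — THEOREM L, integrated robust form — for the same solutions, every g > 0 and
0 ≤ t₁ ≤ t₂ < T: if Φ is a measurable majorant of Λ_g on (t₁,t₂) with ∫ Φ⁺ ≤ M (M ≥ 0), then ℓ(g,t₂)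
≥ ℓ(g,t₁)·e^(−M) in [0,∞] (so an empty admissible class at t₁ forces an empty one at t₂: circulation
is not created from an irrotational slice; the shortest loop carrying g can shrink only at the rate
of tangential compression of near-taut loops; viscous leakage v∂_γℓ ≥ 0 and stretching phases are
dropped, safe side). [difficulty: L] (why it might fail: Danskin/envelope differentiation of a
min-value with non-unique or degenerate minimisers; needs level-left-continuity of γ ↦ ℓ(γ,t)
uniformly in t and C^{1,1} regularity of Lipschitz minimisers (constraint qualification ∮τ×ω ≠ 0) to
run the pull-back Grönwall.) [doi:10.1002/cpa.20192, arXiv:0912.5226, arXiv:1305.1871,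
MajdaBertozzi2002]
#4 CirculationFloor (crux) — ENTRY TICKET, shared verbatim with route CirculationRelay
(stmt-NavierStokesRegularity-1538): an absolute c₀ > 0 such that a Leray–Hopf classical solution
from a rapidly decaying datum with no smooth extension past T carries, for every δ > 0, circulation
|∮u(t)·dl| ≥ c₀ν on some planar circle of radius ≤ δ at some t < T (contrapositive of
Cheskidov–Shvydkoy Lemma 3.2, p.5, via disc flux = circulation and the heat-kernel characterisation
of B^{-1}_{∞,∞}). [difficulty: M] (why it might fail: Cheskidov–Shvydkoy Lemma 3.2 yields a large
Littlewood–Paley block of u, not one circle: converting it into a single planar circle with |∮u·dl|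
≥ c₀ν needs the disc-flux layer-cake on radial kernel slices; sign-oscillating vorticity inside the
block could leave only a SUM of circulations large.) [arXiv:0708.3067, CheskidovShvydkoy2010,
GigaMiyakawa1989]
#9 TautLoopStatic (support) — STATIC TAUT-LOOP LEMMA (card P1, provable now): for v ∈ C² and a C¹
loop γ with |∮_γ v·dl| ≥ g > 0 whose length equals ℓ(v,g) in [0,∞] (a taut loop): (∮_γ v·dl)·(∮_γ
Δv·dl) ≤ 0 and |∮_γ v·dl| = g (constraint active; a ↦ ∮_{γ+a}v·dl is extremal at a = 0 by
translate-and-shrink, so its Hessian trace ∮Δv·dl has the draining sign). [difficulty: provable-now]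
[arXiv:0912.5226, MajdaBertozzi2002]

TWO-LAYER PLAN. Foreseen glued splits (card K2, K3; nothing filed now): TautCompressionIntegrable ⇐
SelfStrainLocality (compression of a taut loop is
generated by circulation at scales ≳ its own length: ⨍_C(−τ·Sτ) ≤ C Σ_{dyadic r ≥ ℓ/K} N_u(r)/r² +
integrable remainder, N_u(r) = sup of
|∮u·dl| over loops of length ≤ r) → CoarseStrainIntegrable → TautCompressionIntegrable; and the
Type-I endgame TautCompressionIntegrable|TypeI
⇐ SimilarityOverStrain (a Type-I profile must over-strain its taut quantum loops by ≥ ½ on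
s-average) → SaturationRigidity (averaged
saturation forces coaxial Burgers/Lundgren circles, which no bounded profile on ℝ³ self-generates;
NRS1996/Tsai1998/ChaeWolf2017 corner).
TautLoopLaw ⇐ LocalMaterialLemmas (TautLoopStatic + pull-back o(h) uniformity) → LevelLeftContinuity
→ TautLoopLaw.

KILL CRITERIA. A classical solution on which t ↦ ℓ(g,t) drops faster than e^(−∫Λ⁺) (refuting
TautLoopLaw: needs every near-taut loop to mis-predict,
e.g. all taut loops inside {ω = 0}) closes the route `refuted:TautLoopLaw` — the mechanism itself
would be dead. A refutation of
TautCompressionIntegrable is a finite-time blow-up (¬A outright; hand the witness to the negative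
routes). TautLoopStatic refuted (a taut loop
with (∮v)(∮Δv) > 0) kills the sign and hence the line. NoBlowup proved elsewhere moots the route;
CirculationFloor refuted forces a pivot to
the loop form of another critical-norm floor (Giga–Miyakawa / B^{-1}_{∞,∞} with a different
constant) without touching the two cruxes.

NOT DECOMPOSED YET. The exact Dini form of Theorem L with the leakage term v∂_γℓ (sharper, needs
∂_γℓ), existence/C^{1,1}-regularity of minimisers and the
no-downward-jump lemma (children of TautLoopLaw); the self-strain locality estimate and the
similarity over-strain ≥ ½ (children of
TautCompressionIntegrable); the constant c₀ of the Floor; any negative-side use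
(compression-vs-leakage design inequality for relay/merger
cascades) — other routes may consume it.

CHEAPEST FALSIFIER. The static sign lemma on explicit fields — done by hand this session
(translate-and-shrink ⇒ |Γ(a)| ≤ g = |Γ(0)| ⇒ Hessian trace
∮Δu·dl signed; Lamb–Oseen equality, Burgers stationarity, Lundgren saturation re-derived) and by the
card's kit jobs (j004448, j004480,
j004481, j004449: 2-D NS co-rotating pair, ∮Δu·dl ≤ −9.5 at every optimiser, law an identity to 0.1
%/1 %; j004429: 3-D statics, Magnus
residual 3·10⁻⁶). Next cheapest: run the law snapshot-to-snapshot on a 3-D reconnection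
(antiparallel tubes) and check ℓ(t₂) ≥ ℓ(t₁)e^(−∫Λ⁺)
with Λ measured on the optimiser; a violation kills TautLoopLaw before any Lean is written.

NUMBERS. Entry level g = c₀ν with c₀ the absolute constant of Cheskidov–Shvydkoy Lemma 3.2
(arXiv:0708.3067 p.5: limsup_q sup_t λ_q⁻¹‖u_q‖_∞ < cν ⇒
regular). Equality family: Lamb–Oseen ∂ₜℓ = πR_γ/t (pure leakage); Burgers vortex δ² = 4ν/a: −Λ +
v∂_γ log ℓ = −a/2 + 2ν/δ² = 0; Lundgren
a = σ/(T−t): right side −1/(2(T−t)), ℓ ~ √(T−t). Trivial bound Λ_g ≤ ‖∇u‖_∞ (so the criterion is at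
least BKM-strength). Items: 6 after rev 1 (target, 3 cruxes, 1 support, assembly).

DEFINITION REQUESTS. None at open: ℓ, the near-taut compression rate and the admissible class are
INLINED (fully written out, ℓ valued in ℝ≥0∞ via ⨅ over admissible loops) over
Literature.Analysis.FluidPDE.circulation /
IsC1Loop (LoopCirculation.lean), fderiv, Laplacian.laplacian, lintegral. If provers want names:
`circLengthSpectrum`, `tautCompression` under
Summits/NavierStokesRegularity/NavierStokesRegularity/Theorems (card D1) — to be filed by the tenure
planner after the first landing.

Novelty: Searches (2026-08-16, this seat): lever table of all 63 thesis files of the sub (no loop-space /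
length-valued object; KnvAxisInflow two-point max principle closed, axisymmetric); `ledger idea list
--status open` (24 cards; taut-loop-kelvin-law route_id null); `ledger negatives` (3, unrelated);
`lit search` Lei–Lin–Zhou / Chae–Wolf / Córdoba–Fefferman (crossref doi:10.1007/s002200100502 found:
material tube collapse needs ∫‖u‖_∞ = ∞); `lit read arxiv:0708.3067` (Lemma 3.2 p.5 confirmed); `lit
frontier NavierStokesRegularity --since 2024` (30 rows, none on circulation/loop criteria).
Card-side searches (2026-08-15/16, author + critic): zbMATH/Crossref/arXiv/galaxy for "stochastic
Kelvin theorem", "circulation cascade", "loop equation turbulence", "closed magnetic geodesics",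
galaxy intelligent "minimal loop prescribed circulation / viscous Kelvin / shortest loop" (30:
Khesin–Misiołek–Shnirelman arXiv:2205.01143 grep 0, Migdal ×4), openalex "regularity criterion NS
circulation Kelvin loops" (15, stochastic Kelvin only).
Nearest prior art found: doi:10.1002/cpa.20192 (Constantin–Iyer stochastic Kelvin: identity in
expectation, no extremal loop, no sign); arXiv:hep-th/9310088 (Migdal loop calculus, minimal
SURFACES); doi:10.1007/s002200100502 + arXiv:1108.1165 Prop. 52 (non-collapse of MATERIAL tubes);
doi:10.1081/pde-200044488 (Deng–Hou–Yu vortex-line segments, amplitude-valued); arXiv:0708.3067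
Lemma 3.2 (entry ticket); in hub: CirculationRelay (heuristic Kelvin bookkeeping, ne  [refs: 10.1007/s002200100502, 10.1002/cpa.20192, 10.1081/pde-200044488, 0708.3067, 2205.01143, hep-th/9310088, 1108.1165, doi:10.1007/s002200100502, arxiv:0708.3067, doi:10.1002/cpa.20192, doi:10.1081/pde-200044488]

Barriers (technique_class: loop-space-max-principle, kelvin-extremal, refined-bkm): - technique_class: loop-space-max-principle, kelvin-extremal, refined-bkm
- Literature.Barriers.NavierStokesRegularity.TaoAveragedBlowup: evaded — the law uses the exact
Lie-transport structure u·∇u = ω×u + ∇(|u|²/2) through Kelvin on material loops, which no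
rotation/dilation/multiplier average B̃ of the bilinear form retains (B̃ has no loop invariant), so
an argument through TautLoopLaw cannot prove the false averaged statement.
- Literature.Barriers.NavierStokesRegularity.EnergySupercriticality: it does not evade at the level
of TautCompressionIntegrable; the bet is that relocating the whole supercritical gap onto ONE family
of curves with a closed one-sided law (saturated exactly by Lundgren cores) makes self-strain
locality and Type-I saturation rigidity attackable.
- Literature.Barriers.NavierStokesRegularity.NavierStokesInequalitySingularSolution: evaded — Kelvin
is an identity of the EQUATION; for Scheffer/Ożański NSI solutions the hidden force enters ∮f·dl
unsigned and the law fails, so the line distinguishes NS from NSI.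
- Literature.Barriers.NavierStokesRegularity.CriticalBesovNormInflation: consistent — circulation
sup-norms dominate the B^{-1}_{∞,∞} tail (Floor), no well-posedness in that space is claimed.
- Literature.Barriers.NavierStokesRegularity.LeraySelfSimilarBlowupExclusion: consistent and used —
the law is marginal (ℓ ~ √(T−t)) exactly on the self-similar family NRS/Tsai exclude; the Type-I
endgame child leans on it.
- Literature.Barriers.NavierStokesReg

History (route lifecycle, newest last):
- 2026-08-16T14:09:12Z · rev 2: restated TautCompressionIntegrable (stmt-NavierStokesRegularity-15198), TautLoopLaw (stmt-NavierStokesRegularity-15199), TautLoopStatic (stmt-NavierStokesRegularity-15201), Assembly (stmt-NavierStokesRegularity-15203) — rev 2: restate TautCompressionIntegrable / TautLoopLaw / TautLoopStatic / Assembly — ℓ valued (planner-plan-novel-NavierStokesRegularity-Navie-a989c6c0-0)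
- 2026-08-16T14:11:34Z · rev 4: dropped CircleNonCollapseOfLaw, NoBlowupToClay — rev 4: drop supports CircleNonCollapseOfLaw (proved inline in closes rev 3) and NoBlowupToClay (= stmt-0055, proved; invoked as theorem); header thesis/rational (planner-plan-novel-NavierStokesRegularity-Navie-a989c6c0-0)
- 2026-08-16T14:12:06Z · rev 5: dropped CirculationFloor — rev 5 (cosmetic): re-attach the shared entry ticket CirculationFloor (stmt-1538) as crux RANK 4 (retriage could only change its kind, leaving rank 9) (planner-plan-novel-NavierStokesRegularity-Navie-a989c6c0-0)

sub-problem: NavierStokesRegularity · status: draft · opened planner-plan-novel-NavierStokesRegularity-Navie-a989c6c0-0 2026-08-16T14:01:35Z · rev 6 · ledger route-NavierStokesRegularity-TautLoopKelvin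
GENERATED by the gate from the ledger (D-0016/17). Provers cite these decls: `theorem foo : Summit.NavierStokesRegularity.NavierStokesRegularity.Theses.TautLoopKelvin.<Decl> := …` in Summits/NavierStokesRegularity/NavierStokesRegularity/Theorems/<Name>.lean.
-/

namespace Summit.NavierStokesRegularity.NavierStokesRegularity.Theses.TautLoopKelvin

open scoped BigOperators Topology Manifold Classical MeasureTheory ProbabilityTheory Matrix InnerProductSpace ComplexConjugate ContinuousMap
open Filter Set Function TopologicalSpace MeasureTheory

attribute [summit_statement] _root_.NavierStokesRegularity

open Literature.NS

/-- item stmt-NavierStokesRegularity-15197 · target · rank 0 · open · by planner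
why it might fail: with CirculationFloor it is equivalent to no blow-up: it fails exactly on a finite-time singularity (circulation c₀ν on circles of radius → 0), e.g. Hou's interior scenario arXiv:2107.06509 if real.
sources: arXiv:0708.3067, BealeKatoMajda1984, arXiv:2107.06509
[target] X as in § Thesis: for every classical Leray–Hopf solution from a rapidly decaying datum on
[0,T) and every g > 0 there is r₀ > 0 such that every planar circle (orthonormal frame, radius r >
0) with |circulation| ≥ g at some t ∈ [0,T) has r ≥ r₀. -/
@[route_item "route-NavierStokesRegularity-TautLoopKelvin"]
def QuantumCircleNonCollapse : Prop :=
  ∀ (ν T : ℝ), 0 < ν → 0 < T → ∀ (u : ℝ → EuclideanSpace ℝ (Fin 3) → EuclideanSpace ℝ (Fin 3)) (p : ℝ → EuclideanSpace ℝ (Fin 3) → ℝ), Literature.Analysis.FluidPDE.IsClassicalNSSolutionOn (Set.Ico 0 T) ν 0 u p → Literature.Analysis.FluidPDE.IsLerayHopfOn T ν 0 (u 0) u → Literature.Analysis.FluidPDE.HasRapidSpatialDecay (u 0) → ∀ g : ℝ, 0 < g → ∃ r₀ : ℝ, 0 < r₀ ∧ ∀ t ∈ Set.Ico 0 T, ∀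 (c e₁ e₂ : EuclideanSpace ℝ (Fin 3)) (r : ℝ), 0 < r → ‖e₁‖ = 1 → ‖e₂‖ = 1 → inner ℝ e₁ e₂ = 0 → g ≤ |∫ θ in (0 : ℝ)..(2 * Real.pi), inner ℝ (u t (c + (r * Real.cos θ) • e₁ + (r * Real.sin θ) • e₂)) ((-(r * Real.sin θ)) • e₁ + (r * Real.cos θ) • e₂)| → r₀ ≤ r

-- earlier TautCompressionIntegrable (stmt-NavierStokesRegularity-15198, replaced 2026-08-16T14:09:12Z -> stmt-NavierStokesRegularity-15248): retired by None — let len : (ℝ → EuclideanSpace ℝ (Fin 3)) → ℝ := fun γ => ∫ s in (0:ℝ)..1, ‖deriv γ s‖; let ell : (EuclideanSpace ℝ (Fin 3) → EuclideanSpace ℝ (Fin 3)) → ℝ → ℝ := fun v g => sInf (len '' {γ | Literature.Analysis.FluidPDE.IsC1Loop γ ∧ g ≤ |Liter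
/-- item stmt-NavierStokesRegularity-15248 · crux · rank 2 · open · by planner
why it might fail: Λ_g ≤ ‖∇u‖_∞ so it holds up to any regular time, but the law is SATURATED (not violated) by Lundgren's self-similarly collapsing strained core: K1 fails iff a super-Burgers strain on a quantum tube is self-fed until T — the tube scenario itself, carrying the supercritical gap.
sources: Lundgren1982, BealeKatoMajda1984, MoffattKidaOhkitani1994, arXiv:1108.1165
[crux] card K1 in leakage-free sufficient form — for every classical Leray–Hopf solution from a
rapidly decaying datum on [0,T) and every level g > 0, the near-taut compression rate Λ_g(s) :=
inf_{ε>0} sup{ −⨍_C⟨τ,(∇u(s))τ⟩ : C a C¹ loop, |∮_C u(s)·dl| ≥ g, length(C) ≤ ℓ(g,s)+ε } has a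
measurable majorant Φ on (0,T) with ∫₀ᵀ Φ⁺ ≤ M < ∞ (tangential compression of the taut quantum loops
is time-integrable up to T). [difficulty: open-problem] -/
@[route_item "route-NavierStokesRegularity-TautLoopKelvin", crux]
def TautCompressionIntegrable : Prop :=
  ∀ (ν T : ℝ), 0 < ν → 0 < T → ∀ (u : ℝ → EuclideanSpace ℝ (Fin 3) → EuclideanSpace ℝ (Fin 3)) (p : ℝ → EuclideanSpace ℝ (Fin 3) → ℝ), Literature.Analysis.FluidPDE.IsClassicalNSSolutionOn (Set.Ico 0 T) ν 0 u p → Literature.Analysis.FluidPDE.IsLerayHopfOn T ν 0 (u 0) u → Literature.Analysis.FluidPDE.HasRapidSpatialDecay (u 0) → ∀ g : ℝ, 0 < g → ∃ (Φ : ℝ → ℝ) (M : ℝ), Measurable Φ ∧ 0 ≤ M ∧ (∀ s ∈ Set.Ioo 0 T, (⨅ ε : {ε : ℝ // 0 < ε}, sSup {k : ℝ | ∃ γ : ℝ → EuclideanSpace ℝ (Fin 3), Literature.Analysis.FluidPDE.IsC1Loop γ ∧ g ≤ |Literature.Analysis.FluidPDE.circulation (u s) γ| ∧ ENNReal.ofReal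 (∫ σ in (0:ℝ)..1, ‖deriv γ σ‖) ≤ (⨅ (γ' : ℝ → EuclideanSpace ℝ (Fin 3)) (_ : Literature.Analysis.FluidPDE.IsC1Loop γ' ∧ g ≤ |Literature.Analysis.FluidPDE.circulation (u s) γ'|), ENNReal.ofReal (∫ σ in (0:ℝ)..1, ‖deriv γ' σ‖)) + ENNReal.ofReal (ε : ℝ) ∧ k = ((∫ σ in (0:ℝ)..1, -(inner ℝ (deriv γ σ) (fderiv ℝ (u s) (γ σ) (deriv γ σ))) / ‖deriv γ σ‖) / (∫ σ in (0:ℝ)..1, ‖deriv γ σ‖))}) ≤ Φ s) ∧ (∫⁻ s in Set.Ioo 0 T, ENNReal.ofReal (Φ s)) ≤ ENNReal.ofReal M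

-- earlier TautLoopLaw (stmt-NavierStokesRegularity-15199, replaced 2026-08-16T14:09:12Z -> stmt-NavierStokesRegularity-15249): retired by None — let len : (ℝ → EuclideanSpace ℝ (Fin 3)) → ℝ := fun γ => ∫ s in (0:ℝ)..1, ‖deriv γ s‖; let ell : (EuclideanSpace ℝ (Fin 3) → EuclideanSpace ℝ (Fin 3)) → ℝ → ℝ := fun v g => sInf (len '' {γ | Literature.Analysis.FluidPDE.IsC1Loop γ ∧ g ≤ |Literature.Analysis
/-- item stmt-NavierStokesRegularity-15249 · crux · rank 3 · closed · proved by Summit.NavierStokesRegularity.NavierStokesRegularity.Theorems.tautLoopKelvin_tautLoopLaw_proof @ 618d38952c04 (prover) · by planner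
why it might fail: Danskin/envelope differentiation of a min-value with non-unique or degenerate minimisers; needs level-left-continuity of γ ↦ ℓ(γ,t) uniformly in t and C^{1,1} regularity of Lipschitz minimisers (constraint qualification ∮τ×ω ≠ 0) to run the pull-back Grönwall.
sources: doi:10.1002/cpa.20192, arXiv:0912.5226, arXiv:1305.1871, MajdaBertozzi2002
[crux] THEOREM L, integrated robust form — for the same solutions, every g > 0 and 0 ≤ t₁ ≤ t₂ < T:
if Φ is a measurable majorant of Λ_g on (t₁,t₂) with ∫ Φ⁺ ≤ M (M ≥ 0), then ℓ(g,t₂) ≥ ℓ(g,t₁)·e^(−M)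
in [0,∞] (so an empty admissible class at t₁ forces an empty one at t₂: circulation is not created
from an irrotational slice; the shortest loop carrying g can shrink only at the rate of tangential
compression of near-taut loops; viscous leakage v∂_γℓ ≥ 0 and stretching phases are dropped, safe
side). [difficulty: L] -/
@[route_item "route-NavierStokesRegularity-TautLoopKelvin", crux]
def TautLoopLaw : Prop :=
  ∀ (ν T : ℝ), 0 < ν → 0 < T → ∀ (u : ℝ → EuclideanSpace ℝ (Fin 3) → EuclideanSpace ℝ (Fin 3)) (p : ℝ → EuclideanSpace ℝ (Fin 3) → ℝ), Literature.Analysis.FluidPDE.IsClassicalNSSolutionOn (Set.Ico 0 T) ν 0 u p → Literature.Analysis.FluidPDE.IsLerayHopfOn T ν 0 (u 0) u → Literature.Analysis.FluidPDE.HasRapidSpatialDecay (u 0) → ∀ g : ℝ, 0 < g → ∀ t₁ t₂ : ℝ, 0 ≤ t₁ → t₁ ≤ t₂ → t₂ < T → ∀ (Φ : ℝ → ℝ) (M : ℝ), Measurable Φ → 0 ≤ M → (∀ s ∈ Set.Ioo t₁ t₂, (⨅ ε : {ε : ℝ // 0 < ε}, sSup {k : ℝ | ∃ γ : ℝ → EuclideanSpace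 ℝ (Fin 3), Literature.Analysis.FluidPDE.IsC1Loop γ ∧ g ≤ |Literature.Analysis.FluidPDE.circulation (u s) γ| ∧ ENNReal.ofReal (∫ σ in (0:ℝ)..1, ‖deriv γ σ‖) ≤ (⨅ (γ' : ℝ → EuclideanSpace ℝ (Fin 3)) (_ : Literature.Analysis.FluidPDE.IsC1Loop γ' ∧ g ≤ |Literature.Analysis.FluidPDE.circulation (u s) γ'|), ENNReal.ofReal (∫ σ in (0:ℝ)..1, ‖deriv γ' σ‖)) + ENNReal.ofReal (ε : ℝ) ∧ k = ((∫ σ in (0:ℝ)..1, -(inner ℝ (deriv γ σ) (fderiv ℝ (u s) (γ σ) (deriv γ σ))) / ‖deriv γ σ‖) / (∫ σ in (0:ℝ)..1, ‖deriv γ σ‖))}) ≤ Φ s) → (∫⁻ s in Set.Ioo t₁ t₂, ENNReal.ofReal (Φ s)) ≤ ENNReal.ofReal M → (⨅ (γ' : ℝ → EuclideanSpace ℝ (Fin 3)) (_ : Literature.Analysis.FluidPDE.IsC1Loop γ' ∧ g ≤ |Literature.Analysis.FluidPDE.circulation (u t₁) γ'|), ENNReal.ofReal (∫ σ in (0:ℝ)..1,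 ‖deriv γ' σ‖)) * ENNReal.ofReal (Real.exp (-M)) ≤ (⨅ (γ' : ℝ → EuclideanSpace ℝ (Fin 3)) (_ : Literature.Analysis.FluidPDE.IsC1Loop γ' ∧ g ≤ |Literature.Analysis.FluidPDE.circulation (u t₂) γ'|), ENNReal.ofReal (∫ σ in (0:ℝ)..1, ‖deriv γ' σ‖))

-- `TautLoopLaw` holds: proved by `Summit.NavierStokesRegularity.NavierStokesRegularity.Theorems.tautLoopKelvin_tautLoopLaw_proof` @ 618d38952c04 (its module imports this route file, so no `_holds` link can be stated here).

/-- item stmt-NavierStokesRegularity-1538 · crux · rank 4 · closed · proved by Summit.NavierStokesRegularity.NavierStokesRegularity.Theorems.circulationFloor_proof @ 3515dba5fe05 (prover) · by planner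
why it might fail: Cheskidov–Shvydkoy Lemma 3.2 yields a large Littlewood–Paley block of u, not one circle: converting it into a single planar circle with |∮u·dl| ≥ c₀ν needs the disc-flux layer-cake on radial kernel slices; sign-oscillating vorticity inside the block could leave only a SUM of circulations large.
sources: arXiv:0708.3067, CheskidovShvydkoy2010, GigaMiyakawa1989
[support] card (R4), the KELVIN-BATTERY FLOOR in loop language, provable now: there is an absolute
c₀ > 0 such that if a finite-energy classical solution from a rapidly decaying datum on [0,T) has no
smooth extension past T, then for every δ > 0 some slice t < T and some planar circle of radius r ≤
δ (centre c, orthonormal frame e₁,e₂) carry circulation |∮ u(t)·dl| ≥ c₀ν. Proof route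
(contrapositive): circle circulation = disc flux of ω (Stokes, u(t) smooth); slicing a ball by
planes ⊥ n gives |∫_(B_ρ(x)) ω·n| ≤ 2ρ·c₀ν for ρ ≤ δ, all x, n, t; the heat-kernel (radially
decreasing kernel = superposition of balls; the ρ > δ part is bounded by the energy through ∫_(B_ρ)
ω·n = ∮_(∂B_ρ)(ν_out×u)·n and dies super-exponentially) characterisation of negative Besov norms
gives sup_t ‖Δ_q ω(t)‖_∞ ≲ c₀ν 2^(2q), Biot–Savart sup_t 2^(−q)‖Δ_q u(t)‖_∞ ≲ C c₀ν for large q, so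
for c₀ small the in-tree PROVED criterion cheskidov_shvydkoy_dyadic_holds (CheskidovShvydkoy2010
Lemma 3.2) yields a classical representative on (0,T], and the in-tree local theory
(leray_local_regular_H1_holds / leray_continuation_H1_holds) extends past T. Consequences used by
the line: every relay stage and the profile of cr -/
@[route_item "route-NavierStokesRegularity-TautLoopKelvin", crux]
def CirculationFloor : Prop :=
  ∃ c₀ : ℝ, 0 < c₀ ∧ ∀ (ν T : ℝ), 0 < ν → 0 < T → ∀ (u : ℝ → EuclideanSpace ℝ (Fin 3) → EuclideanSpace ℝ (Fin 3)) (p : ℝ → EuclideanSpace ℝ (Fin 3) → ℝ), Literature.Analysis.FluidPDE.IsClassicalNSSolutionOn (Set.Ico 0 T) ν 0 u p → Literature.Analysis.FluidPDE.IsLerayHopfOn T ν 0 (u 0) u → Literature.Analysis.FluidPDE.HasRapidSpatialDecay (u 0) → ¬ Literature.Analysis.FluidPDE.HasSmoothExtensionPast ν 0 u T → ∀ δ : ℝ, 0 < δ → ∃ t ∈ Set.Ico 0 T, ∃ (c e₁ e₂ : EuclideanSpace ℝ (Fin 3)) (r : ℝ), 0 < r ∧ r ≤ δ ∧ ‖e₁‖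 = 1 ∧ ‖e₂‖ = 1 ∧ inner ℝ e₁ e₂ = 0 ∧ c₀ * ν ≤ |∫ θ in (0 : ℝ)..(2 * Real.pi), inner ℝ (u t (c + (r * Real.cos θ) • e₁ + (r * Real.sin θ) • e₂)) ((-(r * Real.sin θ)) • e₁ + (r * Real.cos θ) • e₂)|

-- `CirculationFloor` holds: proved by `Summit.NavierStokesRegularity.NavierStokesRegularity.Theorems.circulationFloor_proof` @ 3515dba5fe05 (its module imports this route file, so no `_holds` link can be stated here).

-- earlier TautLoopStatic (stmt-NavierStokesRegularity-15201, replaced 2026-08-16T14:09:12Z -> stmt-NavierStokesRegularity-15250): retired by None — let len : (ℝ → EuclideanSpace ℝ (Fin 3)) → ℝ := fun γ => ∫ s in (0:ℝ)..1, ‖deriv γ s‖; let ell : (EuclideanSpace ℝ (Fin 3) → EuclideanSpace ℝ (Fin 3)) → ℝ → ℝ := fun v g => sInf (len '' {γ | Literature.Analysis.FluidPDE.IsC1Loop γ ∧ g ≤ |Literature.Analy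
/-- item stmt-NavierStokesRegularity-15250 · support · rank 9 · closed · proved by Summit.NavierStokesRegularity.NavierStokesRegularity.Theorems.tautLoopKelvin_tautLoopStatic_proof (prover) · by planner
sources: arXiv:0912.5226, MajdaBertozzi2002
[support] STATIC TAUT-LOOP LEMMA (card P1, provable now): for v ∈ C² and a C¹ loop γ with |∮_γ v·dl|
≥ g > 0 whose length equals ℓ(v,g) in [0,∞] (a taut loop): (∮_γ v·dl)·(∮_γ Δv·dl) ≤ 0 and |∮_γ v·dl|
= g (constraint active; a ↦ ∮_{γ+a}v·dl is extremal at a = 0 by translate-and-shrink, so its Hessian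
trace ∮Δv·dl has the draining sign). [difficulty: provable-now] -/
@[route_item "route-NavierStokesRegularity-TautLoopKelvin"]
def TautLoopStatic : Prop :=
  ∀ (v : EuclideanSpace ℝ (Fin 3) → EuclideanSpace ℝ (Fin 3)), ContDiff ℝ 2 v → ∀ g : ℝ, 0 < g → ∀ γ : ℝ → EuclideanSpace ℝ (Fin 3), Literature.Analysis.FluidPDE.IsC1Loop γ → g ≤ |Literature.Analysis.FluidPDE.circulation v γ| → ENNReal.ofReal (∫ σ in (0:ℝ)..1, ‖deriv γ σ‖) = (⨅ (γ' : ℝ → EuclideanSpace ℝ (Fin 3)) (_ : Literature.Analysis.FluidPDE.IsC1Loop γ' ∧ g ≤ |Literature.Analysis.FluidPDE.circulation v γ'|), ENNReal.ofReal (∫ σ in (0:ℝ)..1, ‖deriv γ' σ‖)) → Literature.Analysis.FluidPDE.circulation v γ * (∫ σ in (0:ℝ)..1, inner ℝ (Laplacian.laplacian v (γ σ)) (deriv γ σ)) ≤ 0 ∧ |Literature.Analysis.FluidPDE.circulation v γ| = g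

-- `TautLoopStatic` holds: proved by `Summit.NavierStokesRegularity.NavierStokesRegularity.Theorems.tautLoopKelvin_tautLoopStatic_proof` (its module imports this route file, so no `_holds` link can be stated here).

-- earlier Assembly (stmt-NavierStokesRegularity-15203, replaced 2026-08-16T14:09:12Z -> stmt-NavierStokesRegularity-15251): retired by None — TautLoopLaw → TautCompressionIntegrable → CircleNonCollapseOfLaw → CirculationFloor → NoBlowupToClay → NavierStokesRegularity
/-- item stmt-NavierStokesRegularity-15251 · assembly · rank 1 · closed · proved by Summit.NavierStokesRegularity.NavierStokesRegularity.Theorems.tautLoopKelvin_assembly_proof (prover) · by planner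
sources: Fefferman2000, arXiv:0708.3067
[assembly] TautCompressionIntegrable → TautLoopLaw → CirculationFloor → NavierStokesRegularity. -/
@[route_item "route-NavierStokesRegularity-TautLoopKelvin"]
def Assembly : Prop :=
  TautCompressionIntegrable → TautLoopLaw → CirculationFloor → NavierStokesRegularity

-- `Assembly` holds: proved by `Summit.NavierStokesRegularity.NavierStokesRegularity.Theorems.tautLoopKelvin_assembly_proof` (its module imports this route file, so no `_holds` link can be stated here).

/-! D-0027 §2.1 — DECIDING THEOREM (planner-authored via `route open/edit --closes-file`; by planner-plan-novel-NavierStokesRegularity-Navie-a989c6c0-0 2026-08-16T14:09:56Z):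
its hypotheses are this route's items and its conclusion the sub-problem Statement (glue_lint), and it elaborates with this file. -/

@[closes "route-NavierStokesRegularity-TautLoopKelvin"] theorem closes (hK1 : TautCompressionIntegrable) (hLaw : TautLoopLaw) (hFloor : CirculationFloor) :
    NavierStokesRegularity := by
  refine _root_.Summit.NavierStokesRegularity.NavierStokesRegularity.Theorems.typeICertificateLadder_noBlowupToClay_proof ?_
  intro ν T hν hT u p hcl hLH hdec
  by_contra hext
  obtain ⟨c₀, hc₀, hF⟩ := hFloor
  have hgpos : 0 < c₀ * ν := mul_pos hc₀ hν
  -- a sup bound for the datum from rapid decay (n = 0, K = 0)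
  obtain ⟨C₀, hC₀⟩ := hdec 0 0
  have hu0 : ∀ x, ‖u 0 x‖ ≤ max C₀ 1 := by
    intro x
    have h := hC₀ x
    rw [pow_zero, one_mul, norm_iteratedFDeriv_zero] at h
    exact h.trans (le_max_left _ _)
  have hCpos : 0 < max C₀ 1 := lt_of_lt_of_le one_pos (le_max_right _ _)
  -- crux K1 at the quantum level g = c₀ ν
  obtain ⟨Φ, M, hΦ, hM, hmaj, hint⟩ := hK1 ν T hν hT u p hcl hLH hdec (c₀ * ν) hgpos
  -- the radius floor
  set ρ : ℝ := (c₀ * ν / max C₀ 1) * Real.exp (-M) with hρ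
  have hρpos : 0 < ρ := mul_pos (div_pos hgpos hCpos) (Real.exp_pos _)
  -- the Floor: a small circle carrying the quantum
  obtain ⟨t, ht, c, e₁, e₂, r, hr, hrδ, he₁, he₂, he12, hcirc⟩ :=
    hF ν T hν hT u p hcl hLH hdec hext (ρ / (8 * Real.pi)) (div_pos hρpos (by positivity))
  -- the taut-loop law from 0 to t at level g
  have hlaw := hLaw ν T hν hT u p hcl hLH hdec (c₀ * ν) hgpos 0 t le_rfl ht.1 ht.2 Φ M hΦ hM
    (fun s hs => hmaj s ⟨hs.1, hs.2.trans ht.2⟩)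
    ((MeasureTheory.lintegral_mono_set (Set.Ioo_subset_Ioo le_rfl ht.2.le)).trans hint)
  -- the circle is admissible at time t, so the spectrum at t is below its length
  set γc : ℝ → EuclideanSpace ℝ (Fin 3) := Literature.Analysis.FluidPDE.circleLoop c r e₁ e₂ with hγc
  have hadm : Literature.Analysis.FluidPDE.IsC1Loop γc ∧ c₀ * ν ≤ |Literature.Analysis.FluidPDE.circulation (u t) γc| := by
    refine ⟨Literature.Analysis.FluidPDE.isC1Loop_circleLoop c r e₁ e₂, ?_⟩
    rw [hγc, Literature.Analysis.FluidPDE.circulation_circleLoop]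
    exact hcirc
  have hupper : (⨅ (γ' : ℝ → EuclideanSpace ℝ (Fin 3)) (_ : Literature.Analysis.FluidPDE.IsC1Loop γ' ∧ c₀ * ν ≤ |Literature.Analysis.FluidPDE.circulation (u t) γ'|), ENNReal.ofReal (∫ σ in (0:ℝ)..1, ‖deriv γ' σ‖)) ≤ ENNReal.ofReal (∫ σ in (0:ℝ)..1, ‖deriv γc σ‖) :=
    iInf₂_le γc hadm
  -- the length of the circle is at most 4πr
  have hlen : (∫ σ in (0:ℝ)..1, ‖deriv γc σ‖) ≤ 4 * Real.pi * r := by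
    have hbound : ∀ σ ∈ Set.uIoc (0:ℝ) 1, ‖(fun σ => ‖deriv γc σ‖) σ‖ ≤ 4 * Real.pi * r := by
      intro σ _
      have h1 : ‖(-(r * Real.sin (2 * Real.pi * σ))) • e₁ + (r * Real.cos (2 * Real.pi * σ)) • e₂‖ ≤ r + r := by
        refine (norm_add_le _ _).trans (add_le_add ?_ ?_)
        · rw [norm_smul, he₁, mul_one, norm_neg, Real.norm_eq_abs, abs_mul, abs_of_pos hr]
          exact mul_le_of_le_one_right hr.le (Real.abs_sin_le_one _)
        · rw [norm_smul, he₂, mul_one, Real.norm_eq_abs, abs_mul, abs_of_pos hr]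
          exact mul_le_of_le_one_right hr.le (Real.abs_cos_le_one _)
      have h2 : ‖(2 * Real.pi : ℝ)‖ = 2 * Real.pi := by
        rw [Real.norm_eq_abs, abs_of_pos Real.two_pi_pos]
      show ‖‖deriv γc σ‖‖ ≤ 4 * Real.pi * r
      rw [norm_norm, hγc, Literature.Analysis.FluidPDE.deriv_circleLoop, norm_smul, h2]
      have h3 := mul_le_mul_of_nonneg_left h1 Real.two_pi_pos.le
      linarith
    have h4 := intervalIntegral.norm_integral_le_of_norm_le_const hbound
    rw [sub_zero, abs_one, mul_one] at h4
    exact (Real.le_norm_self _).trans h4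
  -- at time 0 every admissible loop is long: |∮u₀| ≤ sup|u₀| · length
  have hlower : ENNReal.ofReal (c₀ * ν / max C₀ 1) ≤ (⨅ (γ' : ℝ → EuclideanSpace ℝ (Fin 3)) (_ : Literature.Analysis.FluidPDE.IsC1Loop γ' ∧ c₀ * ν ≤ |Literature.Analysis.FluidPDE.circulation (u 0) γ'|), ENNReal.ofReal (∫ σ in (0:ℝ)..1, ‖deriv γ' σ‖)) := by
    refine le_iInf₂ (fun γ hγ => ?_)
    apply ENNReal.ofReal_le_ofReal
    rw [div_le_iff₀ hCpos]
    have hγ1 := hγ.1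
    have hcont : Continuous (u 0) := (hcl.contDiff_velocity ⟨le_rfl, hT⟩).continuous
    have hint_le : |Literature.Analysis.FluidPDE.circulation (u 0) γ| ≤ max C₀ 1 * ∫ σ in (0:ℝ)..1, ‖deriv γ σ‖ := by
      unfold Literature.Analysis.FluidPDE.circulation
      rw [← intervalIntegral.integral_const_mul]
      refine (intervalIntegral.abs_integral_le_integral_abs zero_le_one).trans ?_
      refine intervalIntegral.integral_mono_on zero_le_one ?_ ?_ (fun σ _ => ?_)
      · exact ((hcont.comp hγ1.continuous).inner hγ1.continuous_deriv).abs.intervalIntegrable 0 1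
      · exact (continuous_const.mul hγ1.continuous_deriv.norm).intervalIntegrable 0 1
      · exact (abs_real_inner_le_norm _ _).trans (mul_le_mul_of_nonneg_right (hu0 _) (norm_nonneg _))
    calc c₀ * ν ≤ |Literature.Analysis.FluidPDE.circulation (u 0) γ| := hγ.2
      _ ≤ max C₀ 1 * ∫ σ in (0:ℝ)..1, ‖deriv γ σ‖ := hint_le
      _ = (∫ σ in (0:ℝ)..1, ‖deriv γ σ‖) * max C₀ 1 := mul_comm _ _
  -- chain everything in ℝ≥0∞ and come back to ℝ
  have hchain : ENNReal.ofReal ρ ≤ ENNReal.ofReal (4 * Real.pi * r) := by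
    calc ENNReal.ofReal ρ
        = ENNReal.ofReal (c₀ * ν / max C₀ 1) * ENNReal.ofReal (Real.exp (-M)) := by
          rw [hρ, ENNReal.ofReal_mul (div_pos hgpos hCpos).le]
      _ ≤ (⨅ (γ' : ℝ → EuclideanSpace ℝ (Fin 3)) (_ : Literature.Analysis.FluidPDE.IsC1Loop γ' ∧ c₀ * ν ≤ |Literature.Analysis.FluidPDE.circulation (u 0) γ'|), ENNReal.ofReal (∫ σ in (0:ℝ)..1, ‖deriv γ' σ‖)) * ENNReal.ofReal (Real.exp (-M)) := mul_le_mul_left hlower _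
      _ ≤ (⨅ (γ' : ℝ → EuclideanSpace ℝ (Fin 3)) (_ : Literature.Analysis.FluidPDE.IsC1Loop γ' ∧ c₀ * ν ≤ |Literature.Analysis.FluidPDE.circulation (u t) γ'|), ENNReal.ofReal (∫ σ in (0:ℝ)..1, ‖deriv γ' σ‖)) := hlaw
      _ ≤ ENNReal.ofReal (∫ σ in (0:ℝ)..1, ‖deriv γc σ‖) := hupper
      _ ≤ ENNReal.ofReal (4 * Real.pi * r) := ENNReal.ofReal_le_ofReal hlen
  have hρle : ρ ≤ 4 * Real.pi * r :=
    (ENNReal.ofReal_le_ofReal_iff (mul_nonneg (by positivity) hr.le)).1 hchain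
  -- contradiction with r ≤ ρ / (8π)
  have h5 : 4 * Real.pi * r ≤ ρ / 2 := by
    have h6 := mul_le_mul_of_nonneg_left hrδ (by positivity : (0:ℝ) ≤ 4 * Real.pi)
    calc 4 * Real.pi * r ≤ 4 * Real.pi * (ρ / (8 * Real.pi)) := h6
      _ = ρ / 2 := by field_simp; ring
  linarith

end Summit.NavierStokesRegularity.NavierStokesRegularity.Theses.TautLoopKelvin
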